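import Summits.BirchSwinnertonDyer.BirchSwinnertonDyer.Theorems.ByReductionTypeAtTwoRankOneAtTwoBigImageOddLocalOneDoorGlue
import HarnessLib

/-!
# Route ByReductionTypeAtTwo, crux `RankOneAtTwoBigImageOddLocal` (stmt-BirchSwinnertonDyer-23715), line `one_door_law`:
# the door law is LOSSLESS — at every admissible door datum, `BSD₂(E) ⟺ (2m + [Δ<0] = ord₂ #Ш(E)[2^∞] + t + 2s)`

Lead prover seat `bsd-line-fkl-p1` g6 (2026-08-28).  Companion of `…OneDoorGlue.lean` (the glue `stub_doorGlue`, sufficiency of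
the door index law).  Here the SAME bookkeeping is run through the tree door `P2.bsdp_two_iff_of_heegner_rankOne` as an
EQUIVALENCE, per datum: for `W` on the slice (non-CM is not even needed; odd torsion, odd Tamagawa product, analytic rank `1`),
an imaginary quadratic `K` with door-admissible, `Sel₂`-trivialising discriminant satisfying the Heegner hypothesis, an
odd-constant parametrisation datum, a Heegner datum, an embedding and the `K`-rational Heegner point `P`, GIVEN the published
inputs at `(N_E, W, K)` and the value law for the minimal twist model:

* `exists_twoDivisibility_of_rankOne` — every point of infinite order of a rank-one `E(K)` has an exact `2`-divisibility
  exponent modulo torsion (the `m` of the law is a well-defined datum, not an extra hypothesis);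
* `bsdp_two_iff_doorLaw_at` — `BSDp W 2 ↔ ∃ m, HasTwoDivisibilityUpToTorsion W K P m ∧ 2m + [Δ<0] = ord₂ #Ш(W)[2^∞] + t + 2s`.

Consequence for the line: on the slice, modulo `S_pub`, `DoorTwistValueAtTwo`, `DoorSupplyAtTwo`, `S_manin`, the conjecture
`DoorIndexLawAtTwo` is not only sufficient (the glue) but NECESSARY at every supplied datum — the line loses nothing; a certified
row violating the law refutes BSD₂ for that curve or one of the three side inputs, never the bookkeeping.  BSD is not proved by
any of this.
-/

set_option autoImplicit false

noncomputable section

open scoped Classical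

set_option linter.dupNamespace false

namespace Summit.BirchSwinnertonDyer.BirchSwinnertonDyer.Theorems.RankOneAtTwoOneDoor

open WeierstrassCurve NumberField IsDedekindDomain Rat.HeightOneSpectrum Literature.NumberTheory.EllipticCurves
  Literature.NumberTheory.EllipticCurves.ModularForms
  Literature.NumberTheory.EllipticCurves.KrizLi2019
  Summit.BirchSwinnertonDyer.Rank1Residual.F1Sign2
  Summit.BirchSwinnertonDyer.Rank1Residual.F1Sign2.TranspositionDoor
  Summit.BirchSwinnertonDyer.Rank1Residual

/-- **Exact `2`-divisibility exponent exists** for a point of infinite order in `E(K)` of rank one: `P ≡ a g` with `a ≠ 0`,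
`a = 2^m b` with `b` odd, `Q := b g`; then `P − 2^m Q` is torsion and `Q` is not twice a point modulo torsion (coefficients
modulo torsion are unique). [folklore] -/
theorem exists_twoDivisibility_of_rankOne {K : Type} [Field K] [NumberField K] (V : WeierstrassCurve K) [V.IsElliptic]
    {g : V.toAffine.Point}
    (hgen : ∀ y : V.toAffine.Point, ∃ n : ℤ, y - n • g ∈ AddCommGroup.torsion V.toAffine.Point)
    (huniq : ∀ n : ℤ, n • g ∈ AddCommGroup.torsion V.toAffine.Point → n = 0)
    {P : V.toAffine.Point} (hP : ¬ IsOfFinAddOrder P) :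
    ∃ (m : ℕ) (Q : V.toAffine.Point), P - (2 ^ m) • Q ∈ AddCommGroup.torsion V.toAffine.Point ∧
      ¬ ∃ Q' : V.toAffine.Point, Q - 2 • Q' ∈ AddCommGroup.torsion V.toAffine.Point := by
  set T := AddCommGroup.torsion V.toAffine.Point with hT_def
  obtain ⟨a, ha⟩ := hgen P
  have ha0 : a ≠ 0 := by
    rintro rfl
    rw [zero_smul, sub_zero] at ha
    exact hP ((AddCommGroup.mem_torsion _).mp ha)
  -- uniqueness of coefficients modulo `T`
  have hcoef : ∀ {x : V.toAffine.Point} {u v : ℤ}, x - u • g ∈ T → x - v • g ∈ T → u = v := by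
    intro x u v hu hv
    have hmem : (u - v) • g ∈ T := by
      have : (u - v) • g = (x - v • g) - (x - u • g) := by rw [sub_smul]; abel
      rw [this]; exact T.sub_mem hv hu
    have := huniq (u - v) hmem
    omega
  -- `a = 2^m b`, `b` odd
  set m : ℕ := (multiplicity 2 a) with hm_def
  have hfin : FiniteMultiplicity (2 : ℤ) a := Int.finiteMultiplicity_iff.mpr ⟨by norm_num, ha0⟩
  obtain ⟨b, hab⟩ : (2 : ℤ) ^ m ∣ a := pow_multiplicity_dvd 2 a
  have hbodd : ¬ (2 : ℤ) ∣ b := by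
    rintro ⟨b', rfl⟩
    have : (2 : ℤ) ^ (m + 1) ∣ a := ⟨b', by rw [hab]; ring⟩
    exact hfin.not_pow_dvd_of_multiplicity_lt (Nat.lt_succ_self m) this
  refine ⟨m, b • g, ?_, ?_⟩
  · have : (2 ^ m) • (b • g) = a • g := by
      rw [hab, mul_smul, ← natCast_zsmul (b • g) (2 ^ m)]; push_cast; rfl
    rw [this]; exact ha
  · rintro ⟨Q', hQ'⟩
    obtain ⟨e, he⟩ := hgen Q'
    have h1 : b • g - (2 * e) • g ∈ T := by
      have hB : (2 : ℕ) • Q' - (2 * e) • g ∈ T := by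
        have : (2 : ℕ) • Q' - (2 * e) • g = (2 : ℤ) • (Q' - e • g) := by
          rw [smul_sub, mul_smul, ← natCast_zsmul Q' 2]; push_cast; rfl
        rw [this]; exact T.zsmul_mem he 2
      have : b • g - (2 * e) • g = (b • g - (2 : ℕ) • Q') + ((2 : ℕ) • Q' - (2 * e) • g) := by abel
      rw [this]; exact T.add_mem hQ' hB
    have h0 : b • g - b • g ∈ T := by rw [sub_self]; exact T.zero_mem
    have hbe : b = 2 * e := hcoef h0 h1
    exact hbodd ⟨e, hbe⟩

/-- **The door law is an EQUIVALENCE at every admissible datum.**  `W/ℚ` globally minimal, odd `#E(ℚ)_tors`, odd `∏ c_ℓ`,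
analytic rank `1`; `K` imaginary quadratic with `d_K` door-admissible, `Sel₂(W^{(d_K)}) = 0`, Heegner hypothesis for `N_E`;
`Dt` a parametrisation datum of level `N_E` with odd constant, `H`, `ι`, and `P ∈ E(K)` mapping to the complex Heegner point;
published inputs Gross–Zagier / Kolyvagin at `(N_E, W, K)`, GZK, modularity; and the value law `DoorTwistValueAtTwo`.  THEN
`BSDp W 2 ↔ ∃ m, (P ≡ 2^m Q, Q not twice, mod torsion) ∧ 2m + [Δ_W < 0] = ord₂ #Ш(W)[2^∞] + t + 2s`.
[cite: GrossZagier1986, Thm. I.6.3 and V.§2] [cite: Pal2012, Prop. 2.5 and Cor. 2.6] -/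
theorem bsdp_two_iff_doorLaw_at
    (hGZK : rank_eq_analyticRank_of_analyticRank_le_one) (hmod : hasEntireLFunction_rat) (hVal : DoorTwistValueAtTwo)
    (W : WeierstrassCurve ℚ) [W.IsElliptic] [W.IsGloballyMinimal] [NeZero (W.conductorNorm ℤ)]
    (hCM : ¬ W.HasCM) (hT : Odd W.torsionOrder) (hc : Odd W.tamagawaProduct) (hr : W.analyticRank = 1)
    (K : Type) [Field K] [NumberField K] (hK : IsImaginaryQuadratic K)
    (hGZ : gross_zagier (W.conductorNorm ℤ) W K) (hKo : kolyvagin (W.conductorNorm ℤ) W K)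
    (hadm : DoorAdmissible W (NumberField.discr K)) (hSel : twistSelmerTwoCard W (NumberField.discr K) = 1)
    (hHN : SatisfiesHeegnerHypothesis (W.conductorNorm ℤ) K)
    (Dt : ModularParametrizationData W (W.conductorNorm ℤ)) (hcodd : ¬ (2 : ℤ) ∣ Dt.c)
    (H : HeegnerDatum (W.conductorNorm ℤ) (NumberField.discr K)) (ι : K →+* ℂ)
    (P : (W.baseChange K).toAffine.Point)
    (hP : WeierstrassCurve.Affine.Point.map ι.toRatAlgHom P = heegnerPointComplex Dt H) :
    Finite (AddCommGroup.primaryComponent W.sha 2) ∧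
      (BSDp W 2 ↔
        ∃ m : ℕ, HasTwoDivisibilityUpToTorsion W K P m ∧
          2 * m + (if W.Δ < 0 then 1 else 0) =
            padicValNat 2 (Nat.card (AddCommGroup.primaryComponent W.sha 2)) +
              transpCount W (NumberField.discr K) + 2 * identCount W (NumberField.discr K)) := by
  haveI : Fact (Nat.Prime 2) := ⟨Nat.prime_two⟩
  have hT2 : NoRationalTwoTorsion W := noRationalTwoTorsion_of_odd_torsionOrder W hT
  have h2 : Module.finrank ℚ K = 2 := hK.1
  haveI : IsTotallyComplex K := hK.2
  -- the minimal twist model and the value law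
  have hD0 : (NumberField.discr K : ℚ) ≠ 0 := by exact_mod_cast NumberField.discr_ne_zero K
  haveI hEt : (W.quadraticTwist (NumberField.discr K : ℚ)).IsElliptic := W.isElliptic_quadraticTwist hD0
  obtain ⟨Cd, hCd⟩ := hasGlobalMinimalModel_rat_holds (W.quadraticTwist (NumberField.discr K : ℚ))
  haveI : (Cd • W.quadraticTwist (NumberField.discr K : ℚ)).IsGloballyMinimal := hCd
  set Wd := Cd • W.quadraticTwist (NumberField.discr K : ℚ) with hWd_def
  have hWd : Cd • W.quadraticTwist (NumberField.discr K : ℚ) = Wd := rfl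
  obtain ⟨qd, hqd, hqd0, hvqd⟩ := hVal W hCM hT2 (NumberField.discr K) hadm hSel Wd Cd hWd
  have hLt : (W.quadraticTwist (NumberField.discr K : ℚ)).entireLFunction 1 ≠ 0 := by
    have hLt' : (W.quadraticTwist (NumberField.discr K : ℚ)).entireLFunction = Wd.entireLFunction := by
      rw [← hWd, entireLFunction_smul]
    rw [hLt']
    intro h0
    apply hqd0
    have : ((qd : ℚ) : ℂ) = 0 := by rw [← hqd, h0, zero_div]
    exact_mod_cast this
  have hc0 : Dt.c ≠ 0 := by
    intro h0; apply hcodd; rw [h0]; exact dvd_zero _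
  -- the door
  obtain ⟨k, hk12, hkiff, hdoor⟩ :=
    P2.bsdp_two_iff_of_heegner_rankOne W (W.conductorNorm ℤ) K Dt H ι P hGZ hKo hGZK hmod hK hHN hP hc0 hr hLt Wd Cd
      hWd qd hqd
  ------------------------------------------------------------------ rank `E(K) = 1`, `Ш(E)` finite
  haveI hEK : (W.baseChange K).IsElliptic := isElliptic_baseChange' W K
  have hL0 : W.entireLFunction 1 = 0 := entireLFunction_one_eq_zero_of_analyticRank_eq_one hr
  obtain ⟨-, hderiv⟩ := leadingLCoeff_eq_deriv_of_analyticRank_eq_one hr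
  have hprod := lDerivEK_eq_deriv_mul W K hmod hL0
  have hLK : LDerivEK W K ≠ 0 := by rw [hprod]; exact mul_ne_zero hderiv hLt
  have hPH : IsHeegnerPoint (W.conductorNorm ℤ) W K P := ⟨Dt, H, ι, hP⟩
  have hPinf : ¬ IsOfFinAddOrder P :=
    (lDerivEK_ne_zero_iff_not_isOfFinAddOrder W (W.conductorNorm ℤ) K hGZ hK hHN hPH).mp hLK
  obtain ⟨hrkK, hShaK⟩ := hKo hK hHN hPH hPinf
  have hShaW : W.ShaFinite := Literature.NumberTheory.EllipticCurves.shaFinite_of_baseChange W K hShaK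
  haveI hfinW : Finite W.sha := hShaW
  have hfin2 : Finite (AddCommGroup.primaryComponent W.sha 2) := inferInstance
  have hrk : W.mordellWeilRank = 1 := by rw [(hGZK W (le_of_eq hr)).1, hr]
  ------------------------------------------------------------------ `#E(K)_tors` odd, `k = 1`
  have htKodd : Odd (W.baseChange K).torsionOrder := odd_torsionOrder_baseChange_of_noRationalTwoTorsion W hT2 K h2
  have hk1 : k = 1 := by
    rcases hk12 with h | h
    · exact h
    · exact absurd (hkiff.mp h) (P2.not_forall_halvable_of_odd_torsionOrder W K h2 hrkK hrk htKodd)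
  have hvtK : padicValNat 2 (W.baseChange K).torsionOrder = 0 :=
    padicValNat.eq_zero_of_not_dvd (fun h => (Nat.not_even_iff_odd.mpr htKodd) (even_iff_two_dvd.mpr h))
  ------------------------------------------------------------------ the generator of `E(K)/tors`
  obtain ⟨gK, hgK, hgenK, huniqK, -⟩ :=
    exists_generator_regulator_eq_of_mordellWeilRank_eq_one (W.baseChange K) hrkK
  ------------------------------------------------------------------ `w_K = 2`, `|u| = 1`, oddness
  have hw2 : Units.torsionOrder K = 2 :=
    Literature.NumberTheory.QuadraticFields.Quadratic.torsionOrder_eq_two_of_discr_lt_neg_four h2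
      (discr_lt_neg_four_of_doorAdmissible hadm)
  have hu1 : |(Cd.u : ℚ)| = 1 := by
    rcases W.u_eq_one_or_eq_neg_one_of_smul_quadraticTwist_of_squarefree (emod_four_of_doorAdmissible hadm)
        hadm.2.1 (good_or_mult_at_dvd_of_doorAdmissible W hadm) Wd Cd hWd with h | h <;> rw [h] <;> simp
  have hvcWn : padicValNat 2 W.tamagawaProduct = 0 :=
    padicValNat.eq_zero_of_not_dvd (fun h => (Nat.not_even_iff_odd.mpr hc) (even_iff_two_dvd.mpr h))
  ------------------------------------------------------------------ the valuation, for ANY exponent `m` of `P`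
  have hΔ0 : W.Δ ≠ 0 := W.isUnit_Δ.ne_zero
  have htW' : (W.torsionOrder : ℚ) ≠ 0 := by exact_mod_cast (W.torsionOrder_pos_holds).ne'
  have htK' : ((W.baseChange K).torsionOrder : ℚ) ≠ 0 := by
    exact_mod_cast ((W.baseChange K).torsionOrder_pos_holds).ne'
  have hcW' : (W.tamagawaProduct : ℚ) ≠ 0 := by exact_mod_cast (W.tamagawaProduct_pos_holds).ne'
  have hcM : (Dt.c : ℚ) ≠ 0 := by exact_mod_cast hc0
  have hw' : (Units.torsionOrder K : ℚ) ≠ 0 := by rw [hw2]; norm_num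
  have hua : |(Cd.u : ℚ)| ≠ 0 := abs_ne_zero.mpr Cd.u.ne_zero
  have hk' : ((k : ℕ) : ℚ) ≠ 0 := by rw [hk1]; norm_num
  have hn12 : (W.baseChange ℝ).numRealComponents = 1 ∨ (W.baseChange ℝ).numRealComponents = 2 :=
    numRealComponents_eq_one_or W
  have hn' : ((W.baseChange ℝ).numRealComponents : ℚ) ≠ 0 := by
    rcases hn12 with h | h <;> rw [h] <;> norm_num
  have h8 : padicValRat 2 (8 : ℚ) = 3 := by
    rw [show (8 : ℚ) = ((2 : ℕ) : ℚ) ^ 3 by norm_num, padicValRat.pow, padicValRat.self one_lt_two]; norm_num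
  have hvtW : padicValRat 2 (W.torsionOrder : ℚ) = 0 := by
    rw [padicValRat.of_nat, padicValNat.eq_zero_of_not_dvd
      (fun h => (Nat.not_even_iff_odd.mpr hT) (even_iff_two_dvd.mpr h))]; rfl
  have hvtKq : padicValRat 2 ((W.baseChange K).torsionOrder : ℚ) = 0 := by
    rw [padicValRat.of_nat, hvtK]; rfl
  have hvcW : padicValRat 2 (W.tamagawaProduct : ℚ) = 0 := by
    rw [padicValRat.of_nat, hvcWn]; rfl
  have hvc : padicValRat 2 (Dt.c : ℚ) = 0 := by
    rw [padicValRat.of_int, padicValInt.eq_zero_of_not_dvd hcodd]; rfl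
  have hvw : padicValRat 2 (Units.torsionOrder K : ℚ) = 1 := by
    rw [hw2]; exact padicValRat.self one_lt_two
  have hvu : padicValRat 2 |(Cd.u : ℚ)| = 0 := by rw [hu1]; exact padicValRat.one
  have hvk : padicValRat 2 ((k : ℕ) : ℚ) = 0 := by
    rw [hk1, Nat.cast_one]; exact padicValRat.one
  have hvqd' : padicValRat 2 qd =
      (transpCount W (NumberField.discr K) : ℤ) + 2 * (identCount W (NumberField.discr K) : ℤ) := by
    rw [hvqd, hvcWn]; push_cast; ring
  have hD1 : ((W.baseChange ℝ).numRealComponents : ℚ) * ((k : ℕ) : ℚ) ^ 2 ≠ 0 :=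
    mul_ne_zero hn' (pow_ne_zero _ hk')
  have hD2 : ((W.baseChange ℝ).numRealComponents : ℚ) * ((k : ℕ) : ℚ) ^ 2 *
      ((W.baseChange K).torsionOrder : ℚ) ^ 2 ≠ 0 := mul_ne_zero hD1 (pow_ne_zero _ htK')
  have hD3 : ((W.baseChange ℝ).numRealComponents : ℚ) * ((k : ℕ) : ℚ) ^ 2 *
      ((W.baseChange K).torsionOrder : ℚ) ^ 2 * (Dt.c : ℚ) ^ 2 ≠ 0 := mul_ne_zero hD2 (pow_ne_zero _ hcM)
  have hD4 : ((W.baseChange ℝ).numRealComponents : ℚ) * ((k : ℕ) : ℚ) ^ 2 *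
      ((W.baseChange K).torsionOrder : ℚ) ^ 2 * (Dt.c : ℚ) ^ 2 * (Units.torsionOrder K : ℚ) ^ 2 ≠ 0 :=
    mul_ne_zero hD3 (pow_ne_zero _ hw')
  have hD5 : ((W.baseChange ℝ).numRealComponents : ℚ) * ((k : ℕ) : ℚ) ^ 2 *
      ((W.baseChange K).torsionOrder : ℚ) ^ 2 * (Dt.c : ℚ) ^ 2 * (Units.torsionOrder K : ℚ) ^ 2 * qd ≠ 0 :=
    mul_ne_zero hD4 hqd0
  have hD6 : ((W.baseChange ℝ).numRealComponents : ℚ) * ((k : ℕ) : ℚ) ^ 2 *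
      ((W.baseChange K).torsionOrder : ℚ) ^ 2 * (Dt.c : ℚ) ^ 2 * (Units.torsionOrder K : ℚ) ^ 2 * qd *
      |(Cd.u : ℚ)| ≠ 0 := mul_ne_zero hD5 hua
  have hD7 : ((W.baseChange ℝ).numRealComponents : ℚ) * ((k : ℕ) : ℚ) ^ 2 *
      ((W.baseChange K).torsionOrder : ℚ) ^ 2 * (Dt.c : ℚ) ^ 2 * (Units.torsionOrder K : ℚ) ^ 2 * qd *
      |(Cd.u : ℚ)| * (W.tamagawaProduct : ℚ) ≠ 0 := mul_ne_zero hD6 hcW'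
  have hden : padicValRat 2 (((W.baseChange ℝ).numRealComponents : ℚ) * ((k : ℕ) : ℚ) ^ 2 *
      ((W.baseChange K).torsionOrder : ℚ) ^ 2 * (Dt.c : ℚ) ^ 2 * (Units.torsionOrder K : ℚ) ^ 2 * qd *
      |(Cd.u : ℚ)| * (W.tamagawaProduct : ℚ)) =
      padicValRat 2 ((W.baseChange ℝ).numRealComponents : ℚ) + 2 +
        ((transpCount W (NumberField.discr K) : ℤ) + 2 * (identCount W (NumberField.discr K) : ℤ)) := by
    rw [padicValRat.mul hD6 hcW', padicValRat.mul hD5 hua, padicValRat.mul hD4 hqd0,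
      padicValRat.mul hD3 (pow_ne_zero _ hw'), padicValRat.mul hD2 (pow_ne_zero _ hcM),
      padicValRat.mul hD1 (pow_ne_zero _ htK'), padicValRat.mul hn' (pow_ne_zero _ hk'),
      padicValRat.pow, padicValRat.pow, padicValRat.pow, padicValRat.pow,
      hvk, hvtKq, hvc, hvw, hvqd', hvu, hvcW]
    ring
  have hprim : padicValNat 2 (Nat.card (AddCommGroup.primaryComponent W.sha 2)) =
      padicValNat 2 (Nat.card W.sha) := padicValNat_card_addPrimaryComponent 2
  -- `[Δ<0]` and `v₂ n` add up to `1`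
  have hsign : padicValRat 2 ((W.baseChange ℝ).numRealComponents : ℚ) + (if W.Δ < 0 then 1 else 0 : ℕ) = 1 := by
    rcases lt_or_gt_of_ne hΔ0 with hneg | hpos
    · rw [if_pos hneg, P2.numRealComponents_eq_one_of_Δ_neg hneg, Nat.cast_one, padicValRat.one]; norm_num
    · rw [if_neg (not_lt.mpr hpos.le), P2.numRealComponents_eq_two_of_Δ_pos hpos, padicValRat.self one_lt_two]
      norm_num
  -- the valuation of the door's rational for a point with exponent `m`
  have hval : ∀ {m : ℕ} {Q : (W.baseChange K).toAffine.Point},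
      P - (2 ^ m) • Q ∈ AddCommGroup.torsion (W.baseChange K).toAffine.Point →
      (¬ ∃ Q' : (W.baseChange K).toAffine.Point,
          Q - 2 • Q' ∈ AddCommGroup.torsion (W.baseChange K).toAffine.Point) →
      padicValRat 2
          (8 * ((AddSubgroup.zmultiples P).index : ℚ) ^ 2 * (W.torsionOrder : ℚ) ^ 2 /
            (((W.baseChange ℝ).numRealComponents : ℚ) * (k : ℚ) ^ 2 *
              ((W.baseChange K).torsionOrder : ℚ) ^ 2 * (Dt.c : ℚ) ^ 2 *
              (Units.torsionOrder K : ℚ) ^ 2 * qd * |(Cd.u : ℚ)| * (W.tamagawaProduct : ℚ))) =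
        3 + 2 * (m : ℤ) - (padicValRat 2 ((W.baseChange ℝ).numRealComponents : ℚ) + 2 +
          ((transpCount W (NumberField.discr K) : ℤ) + 2 * (identCount W (NumberField.discr K) : ℤ))) := by
    intro m Q hPQ hQ
    obtain ⟨hI0, hvIdx⟩ := padicValNat_index_of_twoDivisibility (W.baseChange K) hgK hgenK hPQ hQ
    have hI' : ((AddSubgroup.zmultiples P).index : ℚ) ≠ 0 := by exact_mod_cast hI0
    have hvI : padicValRat 2 ((AddSubgroup.zmultiples P).index : ℚ) = (m : ℤ) := by
      rw [padicValRat.of_nat, hvIdx, hvtK]; push_cast; ring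
    have hA1 : (8 : ℚ) * ((AddSubgroup.zmultiples P).index : ℚ) ^ 2 ≠ 0 :=
      mul_ne_zero (by norm_num) (pow_ne_zero _ hI')
    have hA2 : (8 : ℚ) * ((AddSubgroup.zmultiples P).index : ℚ) ^ 2 * (W.torsionOrder : ℚ) ^ 2 ≠ 0 :=
      mul_ne_zero hA1 (pow_ne_zero _ htW')
    have hnum : padicValRat 2 ((8 : ℚ) * ((AddSubgroup.zmultiples P).index : ℚ) ^ 2 * (W.torsionOrder : ℚ) ^ 2) =
        3 + 2 * (m : ℤ) := by
      rw [padicValRat.mul hA1 (pow_ne_zero _ htW'), padicValRat.mul (by norm_num) (pow_ne_zero _ hI'),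
        padicValRat.pow, padicValRat.pow, h8, hvI, hvtW]
      ring
    rw [padicValRat.div hA2 hD7, hnum, hden]
  refine ⟨hfin2, ?_⟩
  constructor
  · ---------------------------------------------------------------- BSD₂ ⇒ the law at the datum's own exponent
    intro hB
    obtain ⟨m, Q, hPQ, hQ⟩ := exists_twoDivisibility_of_rankOne (W.baseChange K) hgenK huniqK hPinf
    refine ⟨m, ⟨Q, hPQ, hQ⟩, ?_⟩
    have hv := (hdoor.mp hB)
    rw [hval hPQ hQ, ← hprim] at hv
    have hv' := hsign
    zify
    push_cast at hv hv' ⊢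
    linarith
  · ---------------------------------------------------------------- the law ⇒ BSD₂
    rintro ⟨m, ⟨Q, hPQ, hQ⟩, hlaw⟩
    apply hdoor.mpr
    have hQ' : ¬ ∃ Q' : (W.baseChange K).toAffine.Point,
        Q - 2 • Q' ∈ AddCommGroup.torsion (W.baseChange K).toAffine.Point := hQ
    rw [hval hPQ hQ', ← hprim]
    have hlawZ : (2 * m : ℤ) + ((if W.Δ < 0 then 1 else 0 : ℕ) : ℤ) =
        (padicValNat 2 (Nat.card (AddCommGroup.primaryComponent W.sha 2)) : ℤ) +
          transpCount W (NumberField.discr K) + 2 * identCount W (NumberField.discr K) := by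
      exact_mod_cast hlaw
    have hv' := hsign
    linarith

end Summit.BirchSwinnertonDyer.BirchSwinnertonDyer.Theorems.RankOneAtTwoOneDoor

end
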